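import Summits.ResolutionOfSingularities.ResolutionOfSingularities.Theorems.WeightedInvariantIotaSqueezeLE
import Summits.ResolutionOfSingularities.ResolutionOfSingularities.Theorems.WeightedInvariantELadderTwoCentreChartZeros
import HarnessLib

/-!
# E2 centre, word (G-6b) `e2CentreHom`: LEMMA H, steps (c)+(d) — the closure of a HOMOGENEOUS point of maximal `ι` on a unit chart
# lies in `closure (maxLocus₂)`, and the COMPONENT-MAXIMALITY conclusion

Route `ResolutionOfSingularities/WeightedInvariant`, crux `Theses.WeightedInvariant.HypersurfaceCentreConstruction`
(stmt-ResolutionOfSingularities-19897), door line `local-engine` (skeleton v3.12), E2 tier, registered stub `stub_e2_centre_h`, resting on the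
single word (G-6b) (`…ELadderTwoCentreOfHom`).  Proof route «LEMMA H» (`Cruxes/HypersurfaceCentreConstruction/G6B-LEMMA-H.md`): for `η` the
generic point of a component of `closure (maxLocus₂)`, every core `η*` (for a foreign grading) and its unit-chart core `η**` have `ι = mu₂`
(core invariance) and `η** ⤳ η* ⤳ η`; the CLAIM «`closure {η**} ∩ W a ⊆ closure (maxLocus₂)`» then forces `η** = η` by maximality.
This file proves the CLAIM and the maximality conclusion for an ARBITRARY point `y` of a unit chart `W a` whose chart prime is
HOMOGENEOUS for the chart grading, with `mu₂ ≤ ι(y)` and `y ∈ singImage`, under the graded HOM rung and (I0)₂: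
* `Stage.specializes_of_isHomogeneous_primeIdealOf` — a homogeneous chart prime below `𝔭(z)` is below `core 𝔭(z)`: `y ⤳ η(z)`;
* `Stage.exists_mem_maxLocus₂_specializes_of_isHomogeneous` — over every CLOSED point `z = i x` of `closure {y} ∩ W a` lies a point
  `η(z) ∈ maxLocus₂` with `y ⤳ η(z) ⤳ z` (orbit-generic point of …ELadderTwoOrbitClosurePoint; in `singImage` by the torus lemma, `dim ≤ 3` by
  U6, and `ι = mu₂` by the (c7)≤3 sandwich `Stage.mem_maxLocus₂_of_specializes_of_mu₂_le` of …IotaSqueezeLE);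
* `Stage.closure_inter_chart_subset_closure_maxLocus₂_of_isHomogeneous` — **the CLAIM**: `closure {y} ∩ W a ⊆ closure (maxLocus₂)` (closed
  points are dense in the locally closed set: `Y` is Jacobson);
* `Stage.mem_closure_maxLocus₂_of_isHomogeneous` — in particular `y ∈ closure (maxLocus₂)`;
* `Stage.eq_of_isHomogeneous_of_specializes_of_maximal` — **COMPONENT MAXIMALITY**: if moreover `y ⤳ η` for a point `η` that is maximal
  in `closure (maxLocus₂)` under generisation, then `y = η`.
What remains for LEMMA H proper is the production of `η**` from a foreign grading (core invariance of `ι` and of the order `≥ 2` at scheme level,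
…E2CoreInvariance) and the wiring into `E2CentreHomBody` via the (G-6a) kernel.  Def-free helper (`--supports stmt-ResolutionOfSingularities-19897`);
nothing here asserts any clause or anything about resolution of singularities in characteristic `p`; AI-written, weaker than expert review. [OURS · L1 W4.3]
-/

noncomputable section

set_option linter.dupNamespace false -- mandated namespace of this single-conjunct summit

open CategoryTheory AlgebraicGeometry TopologicalSpace IsLocalRing Topology
open Literature.AlgebraicGeometry.Resolution
open Summit.ResolutionOfSingularities.ResolutionOfSingularities.Theorems
open Summit.ResolutionOfSingularities.ResolutionOfSingularities.Cruxes.HypersurfaceCentreConstruction.LocalEngine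

namespace Summit.ResolutionOfSingularities.ResolutionOfSingularities.Theorems.ELadderOne.Stage

variable {k : Type} [Field k] (S : Stage k) {p : ℕ} (ι : (R : Type) → [CommRing R] → R → Ordinal.{0})
  (J : (R : Type) → [CommRing R] → R → ℕ → Ideal R)

/-- **A point with HOMOGENEOUS chart prime specialising to `z` specialises to the point of `core 𝔭(z)`** (a homogeneous ideal below
`𝔭(z)` is below its homogeneous core). [folklore] -/
theorem specializes_of_isHomogeneous_primeIdealOf (a : S.atlas.ι) {y z η : S.Y} (hya : y ∈ (S.atlas.W a : S.Y.Opens))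
    (hza : z ∈ (S.atlas.W a : S.Y.Opens)) (hηa : η ∈ (S.atlas.W a : S.Y.Opens))
    (hhom : letI := S.atlas.gradedRing a
      (((S.atlas.W a).2.primeIdealOf ⟨y, hya⟩).asIdeal).IsHomogeneous (S.atlas.piece a))
    (hcore : letI := S.atlas.gradedRing a
      ((S.atlas.W a).2.primeIdealOf ⟨η, hηa⟩).asIdeal =
        ((((S.atlas.W a).2.primeIdealOf ⟨z, hza⟩).asIdeal).homogeneousCore (S.atlas.piece a)).toIdeal)
    (hyz : y ⤳ z) : y ⤳ η := by
  classical
  letI := S.atlas.gradedRing a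
  rw [S.specializes_iff_primeIdealOf_le a hηa hya, hcore]
  exact le_toIdeal_homogeneousCore_of_isHomogeneous (S.atlas.piece a) hhom
    ((S.specializes_iff_primeIdealOf_le a hza hya).mp hyz)

/-- **LEMMA H, steps (c)+(d) at a closed point.**  Under the graded HOM rung and (I0)₂, on a unit chart `W a`: if `y ∈ W a` has HOMOGENEOUS
chart prime and `mu₂ ≤ ι(y)`, then over every CLOSED point `z = i x ∈ W a` of `singImage` with `y ⤳ z` lies a point `η ∈ maxLocus₂` with
`y ⤳ η ⤳ z` (the orbit-generic point of `core 𝔭(z)`). [folklore] -/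
theorem exists_mem_maxLocus₂_specializes_of_isHomogeneous [CharP k p] [PerfectField k] (hr : PRungGrHomLE 3 p ι J)
    (h0 : S.InvDim₂) {a : S.atlas.ι} (ha : S.IsUnitChart a) {y : S.Y} (hya : y ∈ (S.atlas.W a : S.Y.Opens))
    (hhom : letI := S.atlas.gradedRing a
      (((S.atlas.W a).2.primeIdealOf ⟨y, hya⟩).asIdeal).IsHomogeneous (S.atlas.piece a))
    (hμ : S.mu₂ ι ≤ iotaAt ι S.i.ker y) {x : S.X} (hza : S.i.base x ∈ (S.atlas.W a : S.Y.Opens))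
    (hzc : IsClosed ({S.i.base x} : Set S.Y)) (hzs : S.i.base x ∈ singImage S.i.ker) (hyz : y ⤳ S.i.base x) :
    ∃ η ∈ S.maxLocus₂ ι, y ⤳ η ∧ η ⤳ S.i.base x := by
  classical
  letI := S.atlas.gradedRing a
  obtain ⟨η, hηa, hcore, hηz, hog⟩ := S.exists_orbitGeneric_specializes ha hza hzc
  have hyη : y ⤳ η := S.specializes_of_isHomogeneous_primeIdealOf a hya hza hηa hhom hcore hyz
  have hηsing : η ∈ singImage S.i.ker := S.mem_singImage_of_isOrbitGeneric_of_specializes hog hηz hzs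
  have hdimη : ringKrullDim (S.Y.presheaf.stalk η) ≤ ((3 : ℕ) : WithBot ℕ∞) :=
    S.ringKrullDim_stalk_le_three_of_isOrbitGeneric h0 hηsing hog
  exact ⟨η, (S.mem_maxLocus₂_of_specializes_of_mu₂_le ι J hr ⟨hηsing, hog, hdimη⟩ hyη hμ).1, hyη, hηz⟩

/-- **LEMMA H, the CLAIM.**  Under the graded HOM rung and (I0)₂, on a unit chart `W a`: if `y ∈ W a ∩ singImage` has HOMOGENEOUS chart prime
and `mu₂ ≤ ι(y)`, then `closure {y} ∩ W a ⊆ closure (maxLocus₂)` (the closed points of the locally closed set `closure {y} ∩ W a` are dense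
— `Y` is Jacobson — and each lies under a point of `maxLocus₂` by `exists_mem_maxLocus₂_specializes_of_isHomogeneous`). [folklore] -/
theorem closure_inter_chart_subset_closure_maxLocus₂_of_isHomogeneous [CharP k p] [PerfectField k] (hr : PRungGrHomLE 3 p ι J)
    (h0 : S.InvDim₂) {a : S.atlas.ι} (ha : S.IsUnitChart a) {y : S.Y} (hya : y ∈ (S.atlas.W a : S.Y.Opens))
    (hhom : letI := S.atlas.gradedRing a
      (((S.atlas.W a).2.primeIdealOf ⟨y, hya⟩).asIdeal).IsHomogeneous (S.atlas.piece a))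
    (hμ : S.mu₂ ι ≤ iotaAt ι S.i.ker y) (hys : y ∈ singImage S.i.ker) :
    closure {y} ∩ (S.atlas.W a : Set S.Y) ⊆ closure (S.maxLocus₂ ι) := by
  haveI : JacobsonSpace S.Y := LocallyOfFiniteType.jacobsonSpace S.f
  set T : Set S.Y := closure {y} ∩ (S.atlas.W a : Set S.Y) with hT
  have hTlc : IsLocallyClosed T := isClosed_closure.isLocallyClosed.inter (S.atlas.W a : S.Y.Opens).2.isLocallyClosed
  -- the closed points of `T` lie in `closure (maxLocus₂)`
  have hcl : T ∩ closedPoints S.Y ⊆ closure (S.maxLocus₂ ι) := by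
    rintro z ⟨⟨hzy, hza⟩, hzc⟩
    rw [mem_closedPoints_iff] at hzc
    have hyz : y ⤳ z := specializes_iff_mem_closure.mpr hzy
    have hzs : z ∈ singImage S.i.ker :=
      (isClosed_singImage S.f S.i.ker).closure_subset_iff.mpr (Set.singleton_subset_iff.mpr hys) hzy
    obtain ⟨x, rfl⟩ := S.mem_range_of_mem_singImage hzs
    obtain ⟨η, hηM, -, hηz⟩ := S.exists_mem_maxLocus₂_specializes_of_isHomogeneous ι J hr h0 ha hya hhom hμ hza hzc hzs hyz
    exact closure_mono (Set.singleton_subset_iff.mpr hηM) (specializes_iff_mem_closure.mp hηz)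
  -- density of the closed points (Jacobson)
  have h1 : closure T ⊆ closure (S.maxLocus₂ ι) := by
    rw [← JacobsonSpace.closure_inter_closedPoints_eq_closure hTlc]
    exact isClosed_closure.closure_subset_iff.mpr hcl
  exact subset_closure.trans h1

/-- **In particular such a point lies in `closure (maxLocus₂)`.** [folklore] -/
theorem mem_closure_maxLocus₂_of_isHomogeneous [CharP k p] [PerfectField k] (hr : PRungGrHomLE 3 p ι J)
    (h0 : S.InvDim₂) {a : S.atlas.ι} (ha : S.IsUnitChart a) {y : S.Y} (hya : y ∈ (S.atlas.W a : S.Y.Opens))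
    (hhom : letI := S.atlas.gradedRing a
      (((S.atlas.W a).2.primeIdealOf ⟨y, hya⟩).asIdeal).IsHomogeneous (S.atlas.piece a))
    (hμ : S.mu₂ ι ≤ iotaAt ι S.i.ker y) (hys : y ∈ singImage S.i.ker) : y ∈ closure (S.maxLocus₂ ι) :=
  S.closure_inter_chart_subset_closure_maxLocus₂_of_isHomogeneous ι J hr h0 ha hya hhom hμ hys ⟨subset_closure rfl, hya⟩

/-- **LEMMA H, COMPONENT MAXIMALITY.**  Under the graded HOM rung and (I0)₂: a point `y` of a unit chart with HOMOGENEOUS chart prime,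
`mu₂ ≤ ι(y)` and `y ∈ singImage`, which specialises to a point `η` that is MAXIMAL in `closure (maxLocus₂)` under generisation (e.g. the
generic point of an irreducible component), EQUALS `η`. [folklore] -/
theorem eq_of_isHomogeneous_of_specializes_of_maximal [CharP k p] [PerfectField k] (hr : PRungGrHomLE 3 p ι J)
    (h0 : S.InvDim₂) {a : S.atlas.ι} (ha : S.IsUnitChart a) {y : S.Y} (hya : y ∈ (S.atlas.W a : S.Y.Opens))
    (hhom : letI := S.atlas.gradedRing a
      (((S.atlas.W a).2.primeIdealOf ⟨y, hya⟩).asIdeal).IsHomogeneous (S.atlas.piece a))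
    (hμ : S.mu₂ ι ≤ iotaAt ι S.i.ker y) (hys : y ∈ singImage S.i.ker) {η : S.Y} (hyη : y ⤳ η)
    (hmax : ∀ y' ∈ closure (S.maxLocus₂ ι), y' ⤳ η → η ⤳ y') : y = η :=
  (hyη.antisymm (hmax y (S.mem_closure_maxLocus₂_of_isHomogeneous ι J hr h0 ha hya hhom hμ hys) hyη)).eq

end Summit.ResolutionOfSingularities.ResolutionOfSingularities.Theorems.ELadderOne.Stage

end
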